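import Summits.BirchSwinnertonDyer.Rank1Residual.Ordinary.Conjectures.KolyvaginKimDatumOfKolyvaginSystem
import HarnessLib

/-!
# The Kolyvagin-class datum from a Kolyvagin system — MODULUS-GENERIC forms (the currency junction to the tree's
# canonical-datum / «Euler system ⇒ Kolyvagin system» files, which spell the modulus `(p : ℤ) ^ k * p`)
# (theorems only; nothing asserted; C-16 stays a CONJECTURE)

HONEST FRAMING (cell `b2b-bsdres`, run/shared/lean/b2b/bsd-rank1-residual/, verbatim in every
file): the goal of the cell is to DELETE the COMBINATION-SHAPED residual classes of the
Birch–Swinnerton-Dyer formula for ALL analytic-rank `≤ 1` elliptic curves over `ℚ` — "full BSD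
formula for every rank `≤ 1` curve in class `C`" assembled STRICTLY from published theorems — so
that the rank-`≤ 1` remainder becomes exactly the CONSTRUCTION-SHAPED classes, which are TYPED
(missing-input `Prop`s), NOT attempted. This is not "finishing BSD". Seat `b2b-bsdres-additive-p3`
(X8 prover B / X7 joint; typer-designate for the cell conjecture C-16 = hyp C120.1; ladder BSD:K3 hand-off to cell
`bsd-ssimc`). This file books nothing and moves no mark; X7 / X8 stay CONSTRUCTION-SHAPED; C-16 = CONJECTURE.

## What this file does

`Conjectures/KolyvaginKimDatumOfKolyvaginSystem.lean` derives `KolyvaginKimDatum W f p ℓ k n Q vℓ vp ψ` (the ONE residual input of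
C-16's derivation, `Conjectures/KolyvaginClassDatum.lean`) from a KOLYVAGIN SYSTEM of the tree's vocabulary on the module
`W.torsionGaloisModule ((p ^ n : ℕ) : ℤ)`. The tree's PRODUCERS of such systems and of admissible data — team n1011's
`GaloisImage/KolyvaginSystemOfEulerSystem.lean` (THEOREM D: the derivative family of an Euler system of `T_pE` IS an
`IsKolyvaginSystem`), `GaloisImage/CanonicalKolyvaginDatum*.lean` (THE canonical finite–singular comparison maps,
`HasCanonicalComparison`, and their admissibility = Mazur–Rubin Lemma 1.2.3), `GaloisImage/SakamotoN11Instance.lean`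
(the `ℤ/p^{k+1}`-structure instances) — spell the same module `W.torsionGaloisModule ((p : ℤ) ^ k * p)`. The two integers are
equal but not syntactically, so the module TYPES differ. This file states the derivation for an ARBITRARY integer modulus
`m` with `m = p^n` (proof: `subst`), and specialises to the `(p : ℤ) ^ k * p` spelling, so that a consumer in that currency
applies it with no transport of Galois modules, cohomology groups, Selmer structures or data:

* `kolyvaginKimDatum_of_singularMap_eq_of_modulus_eq`, `kolyvaginKimDatum_of_isKolyvaginSystem_of_modulus_eq` — the two
  theorems of the sibling file with `W.torsionGaloisModule m`, `m = ↑(p ^ n)`, and the Kummer map `kummerMapTorsion W m hdiv`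
  for ANY divisibility witness `hdiv`;
* `kolyvaginKimDatum_of_isKolyvaginSystem_powMul` — the spelling `m = (p : ℤ) ^ k * p`, `n = k + 1` (n1011's instances);
* `kuriharaExactOrderRankOneAtThree_of_isKolyvaginSystem_powMul` — the closed sentence **C-16 ⟸ Poitou–Tate ∧ local Euler
  characteristic ∧ (on every letter: a Kolyvagin system on `E[3^{k′}·3]` = `W.torsionGaloisModule (((3:ℕ):ℤ) ^ k′ * ((3:ℕ):ℤ))`
  for an admissible-at-`vℓ` datum with `κ_1 = κ((3^F·u)·P)` and Kim's reading)** — the shape in which n1011's THEOREM D and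
  canonical-datum theorems (modulus `((3:ℕ):ℤ)^k * ((3:ℕ):ℤ)`) can be fed in directly.

References: B. Mazur, K. Rubin, Mem. AMS 799 (2004), Lemma 1.2.3, Def. 3.2.1, Thm. 3.2.4, Thm. 5.2.12 [MazurRubin2004];
C.-H. Kim, arXiv:2203.12159, §2.2.2, Thm. 3.13, (5.3) [Kim2022StructureSelmer]; R. Sakamoto, JTNB 36 (2024) §2, Def. 4.1
[Sakamoto2024]; J. S. Milne, ADT (2006) I 2.8, 4.10(b) [MilneADT2006]; `HOME/b2b-bsdres-additive-p3/HANDOFF-TO-bsd-ssimc-K3.md` §2.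
-/

noncomputable section

open scoped Classical MatrixGroups ModularForm

open CongruenceSubgroup WeierstrassCurve Literature.NumberTheory.EllipticCurves
  Literature.NumberTheory.EllipticCurves.ModularForms
  Literature.NumberTheory.EllipticCurves.Rank1Residual
  Literature.NumberTheory.GaloisRepresentations Literature.NumberTheory.GaloisCohomology
  Literature.NumberTheory.GaloisRepresentations.DiscreteGaloisModule
  Function NumberField IsDedekindDomain

namespace Summit.BirchSwinnertonDyer.Rank1Residual.Ordinary

/-! ### §1 Arbitrary modulus `m = p^n` -/

section AnyModulus

variable (W : WeierstrassCurve ℚ) [W.IsElliptic] {N : ℕ} (f : CuspForm (Gamma0 N) 2)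
  (p ℓ k n : ℕ) [Fact p.Prime] [Fact ℓ.Prime] (Q : W.toAffine.Point) (vℓ vp : HeightOneSpectrum (𝓞 ℚ))
  (ψ : (q : ℕ) → (ZMod q)ˣ →* Multiplicative (ZMod (p ^ k)))

/-- **`KolyvaginKimDatum` from THE comparison map, any spelling `m` of the modulus `p^n`** (`subst` of
`kolyvaginKimDatum_of_singularMap_eq`): at a good `vℓ ∤ p`, for `fs : H¹(ℚ_{vℓ}, E[m]) → H¹/H¹_ur` bijective on `H¹_ur`, a
class `x ∈ H¹(ℚ, E[m])` Kummer outside `{vℓ, vp}` with `loc^s_{vℓ} x = fs(loc_{vℓ} κ_m(Q))` (Kummer map for ANY divisibility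
witness `hdiv`) and Kim's reading gives the datum. [cite: MazurRubin2004, Def. 1.2.2, Lemma 1.2.3 and Def. 3.2.1]
[cite: Kim2022StructureSelmer, §2.2.2 and Thm. 3.13] -/
theorem kolyvaginKimDatum_of_singularMap_eq_of_modulus_eq {m : ℤ} (hm : m = ((p ^ n : ℕ) : ℤ))
    (hdiv : ∀ P : geomPoints W, ∃ R : geomPoints W, m • R = P)
    (hpv : ((p : ℕ) : 𝓞 ℚ) ∉ vℓ.asIdeal) (hgood : W.HasGoodReductionAt vℓ)
    (fs : galoisCohomology (GaloisRep.toLocal vℓ (W.torsionGaloisModule m)) 1 →+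
      SingularQuotient (GaloisRep.toLocal vℓ (W.torsionGaloisModule m)))
    (hbij : Function.Bijective fun y : unramifiedSubgroup (GaloisRep.toLocal vℓ (W.torsionGaloisModule m)) 1 => fs y)
    {x : galoisCohomology (W.torsionGaloisModule m) 1}
    (hx : ∀ v : Place ℚ, v ∉ ({Sum.inr vℓ, Sum.inr vp} : Finset (Place ℚ)) →
      galoisCohomology.localization (W.torsionGaloisModule m) v 1 x ∈ W.kummerSelmerStructure m v)
    (hKS : singularMap (GaloisRep.toLocal vℓ (W.torsionGaloisModule m))
        (galoisCohomology.localization (W.torsionGaloisModule m) (Sum.inr vℓ) 1 x) =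
      fs (galoisCohomology.localization (W.torsionGaloisModule m) (Sum.inr vℓ) 1 (kummerMapTorsion W m hdiv Q)))
    (hkim : ∀ ψp : galoisCohomology ((W.torsionGaloisModule m).toLocal (Sum.inr vp)) 1 ⧸
        W.kummerSelmerStructure m (Sum.inr vp) ≃+ ZMod (p ^ n),
      (haveI : NeZero ℓ := ⟨(Fact.out : ℓ.Prime).ne_zero⟩
       zmodPowOrd p k (kuriharaNumber f (p ^ k) ℓ ψ)) =
        min k (zmodPowOrd p n (ψp (galoisCohomology.localization (W.torsionGaloisModule m) (Sum.inr vp) 1 x)))) :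
    KolyvaginKimDatum W f p ℓ k n Q vℓ vp ψ := by
  subst hm
  have hx' : x ∈ kummerOutside W (p ^ n) {Sum.inr vℓ, Sum.inr vp} := by
    rw [mem_kummerOutside_iff]
    intro v hv
    exact hx v hv
  exact kolyvaginKimDatum_of_singularMap_eq W f p ℓ k n Q vℓ vp ψ hpv hgood fs hbij hx' hKS hkim

/-- **`KolyvaginKimDatum` from a Kolyvagin system, any spelling `m` of the modulus `p^n`** (`subst` of
`kolyvaginKimDatum_of_isKolyvaginSystem`): a Kolyvagin datum `D` on `E[m]` with `vℓ ∈ 𝒫` and `φ^{fs}_{vℓ}` bijective on `H¹_ur`,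
`vℓ ∤ p` good, `𝓕` Kummer-or-finer off `{vℓ, vp}`, `κ` with `D.IsKolyvaginSystem 𝓕 κ` and `κ_1 = κ_m(Q)` (Kummer map for ANY
divisibility witness `hdiv`), Kim's reading of `κ_{ℓ}` ⟹ the datum. [cite: MazurRubin2004, Thm. 3.2.4 and Thm. 5.2.12]
[cite: Kim2022StructureSelmer, §2.2.2 and Thm. 3.13] [cite: Sakamoto2024, Def. 4.1 (p. 926)] -/
theorem kolyvaginKimDatum_of_isKolyvaginSystem_of_modulus_eq {m : ℤ} (hm : m = ((p ^ n : ℕ) : ℤ))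
    (hdiv : ∀ P : geomPoints W, ∃ R : geomPoints W, m • R = P)
    (hpv : ((p : ℕ) : 𝓞 ℚ) ∉ vℓ.asIdeal) (hgood : W.HasGoodReductionAt vℓ)
    {D : KolyvaginDatum (W.torsionGaloisModule m)} (hDℓ : vℓ ∈ D.primes)
    (hbij : Function.Bijective fun y : unramifiedSubgroup
      (GaloisRep.toLocal vℓ (W.torsionGaloisModule m)) 1 => D.fs vℓ y)
    {𝓕 : SelmerStructure (W.torsionGaloisModule m)}
    (h𝓕 : ∀ v : Place ℚ, v ≠ Sum.inr vℓ → v ≠ Sum.inr vp → 𝓕 v ≤ W.kummerSelmerStructure m v)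
    {κ : Finset (HeightOneSpectrum (𝓞 ℚ)) → galoisCohomology (W.torsionGaloisModule m) 1}
    (hκ : D.IsKolyvaginSystem 𝓕 κ) (h1 : κ ∅ = kummerMapTorsion W m hdiv Q)
    (hkim : ∀ ψp : galoisCohomology ((W.torsionGaloisModule m).toLocal (Sum.inr vp)) 1 ⧸
        W.kummerSelmerStructure m (Sum.inr vp) ≃+ ZMod (p ^ n),
      (haveI : NeZero ℓ := ⟨(Fact.out : ℓ.Prime).ne_zero⟩
       zmodPowOrd p k (kuriharaNumber f (p ^ k) ℓ ψ)) =
        min k (zmodPowOrd p n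
          (ψp (galoisCohomology.localization (W.torsionGaloisModule m) (Sum.inr vp) 1 (κ {vℓ}))))) :
    KolyvaginKimDatum W f p ℓ k n Q vℓ vp ψ := by
  subst hm
  exact kolyvaginKimDatum_of_isKolyvaginSystem W f p ℓ k n Q vℓ vp ψ hpv hgood hDℓ hbij h𝓕 hκ h1 hkim

end AnyModulus

/-! ### §2 The spelling `m = (p : ℤ) ^ k * p` (`E[p^k · p]`, the tree's `ℤ/p^{k+1}`-structure instances) -/

section PowMul

variable (W : WeierstrassCurve ℚ) [W.IsElliptic] {N : ℕ} (f : CuspForm (Gamma0 N) 2)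
  (p ℓ k₀ k : ℕ) [Fact p.Prime] [Fact ℓ.Prime] (Q : W.toAffine.Point) (vℓ vp : HeightOneSpectrum (𝓞 ℚ))
  (ψ : (q : ℕ) → (ZMod q)ˣ →* Multiplicative (ZMod (p ^ k₀)))

omit [Fact p.Prime] [Fact ℓ.Prime] in
/-- `(p : ℤ) ^ k * p = ↑(p ^ (k + 1))`. [folklore] -/
theorem KSDatum.pow_mul_eq_natCast_pow_succ : (p : ℤ) ^ k * (p : ℤ) = ((p ^ (k + 1) : ℕ) : ℤ) := by
  push_cast
  exact (pow_succ (p : ℤ) k).symm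

/-- **`KolyvaginKimDatum` at depth `k + 1` from a Kolyvagin system on `E[p^k · p]`** (the spelling of the tree's
`ℤ/p^{k+1}`-structure instances and canonical-datum theorems): `kolyvaginKimDatum_of_isKolyvaginSystem_of_modulus_eq` with
`m = (p : ℤ) ^ k * p`, `n = k + 1`. [cite: MazurRubin2004, Lemma 1.2.3, Thm. 3.2.4 and Thm. 5.2.12]
[cite: Kim2022StructureSelmer, §2.2.2 and Thm. 3.13] [cite: Sakamoto2024, §2 and Def. 4.1] -/
theorem kolyvaginKimDatum_of_isKolyvaginSystem_powMul
    (hdiv : ∀ P : geomPoints W, ∃ R : geomPoints W, ((p : ℤ) ^ k * (p : ℤ)) • R = P)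
    (hpv : ((p : ℕ) : 𝓞 ℚ) ∉ vℓ.asIdeal) (hgood : W.HasGoodReductionAt vℓ)
    {D : KolyvaginDatum (W.torsionGaloisModule ((p : ℤ) ^ k * (p : ℤ)))} (hDℓ : vℓ ∈ D.primes)
    (hbij : Function.Bijective fun y : unramifiedSubgroup
      (GaloisRep.toLocal vℓ (W.torsionGaloisModule ((p : ℤ) ^ k * (p : ℤ)))) 1 => D.fs vℓ y)
    {𝓕 : SelmerStructure (W.torsionGaloisModule ((p : ℤ) ^ k * (p : ℤ)))}
    (h𝓕 : ∀ v : Place ℚ, v ≠ Sum.inr vℓ → v ≠ Sum.inr vp →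
      𝓕 v ≤ W.kummerSelmerStructure ((p : ℤ) ^ k * (p : ℤ)) v)
    {κ : Finset (HeightOneSpectrum (𝓞 ℚ)) → galoisCohomology (W.torsionGaloisModule ((p : ℤ) ^ k * (p : ℤ))) 1}
    (hκ : D.IsKolyvaginSystem 𝓕 κ) (h1 : κ ∅ = kummerMapTorsion W ((p : ℤ) ^ k * (p : ℤ)) hdiv Q)
    (hkim : ∀ ψp : galoisCohomology ((W.torsionGaloisModule ((p : ℤ) ^ k * (p : ℤ))).toLocal (Sum.inr vp)) 1 ⧸
        W.kummerSelmerStructure ((p : ℤ) ^ k * (p : ℤ)) (Sum.inr vp) ≃+ ZMod (p ^ (k + 1)),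
      (haveI : NeZero ℓ := ⟨(Fact.out : ℓ.Prime).ne_zero⟩
       zmodPowOrd p k₀ (kuriharaNumber f (p ^ k₀) ℓ ψ)) =
        min k₀ (zmodPowOrd p (k + 1)
          (ψp (galoisCohomology.localization (W.torsionGaloisModule ((p : ℤ) ^ k * (p : ℤ))) (Sum.inr vp) 1
            (κ {vℓ}))))) :
    KolyvaginKimDatum W f p ℓ k₀ (k + 1) Q vℓ vp ψ :=
  kolyvaginKimDatum_of_isKolyvaginSystem_of_modulus_eq W f p ℓ k₀ (k + 1) Q vℓ vp ψ
    (KSDatum.pow_mul_eq_natCast_pow_succ p k) hdiv hpv hgood hDℓ hbij h𝓕 hκ h1 hkim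

end PowMul

/-! ### §3 The closed sentence in the `E[3^k · 3]` spelling -/

section Closed

/-- **C-16 (closed sentence) ⟸ Poitou–Tate over `ℚ` ∧ local Euler characteristic at every `ℚ_v` ∧, on C-16's letter,
a KOLYVAGIN SYSTEM on `E[3^{k′}·3] = W.torsionGaloisModule (((3:ℕ):ℤ) ^ k′ * ((3:ℕ):ℤ))` with Kim's reading** — the
modulus spelling of the tree's canonical-datum / admissibility / «Euler system ⇒ Kolyvagin system» theorems (team n1011,
`GaloisImage/`), so that those producers can be fed in with no transport: for every surjective `ψ` there are a depth
`k′ + 1 ≥ k` with `ℓ ∈ 𝒫_{k′+1}`, `u` with `3 ∤ u`, a divisibility witness, a Kolyvagin datum `D ∋ vℓ` on `E[3^{k′}·3]` admissible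
at `vℓ`, a Selmer structure Kummer-or-finer off `{vℓ, v₃}`, and a Kolyvagin system `κ` with `κ_1 = κ((3^F·u)·P)` whose class
`κ_{ℓ}` has Kim's reading at `v₃`. Nothing asserted; C-16 stays a CONJECTURE (the displayed input is print for `p ≥ 5`,
OPEN at `p = 3`). [cite: MazurRubin2004, Thm. 3.2.4 and Thm. 5.2.12] [cite: Kim2022StructureSelmer, Thm. 3.13 and (5.3)]
[cite: MilneADT2006, Ch. I, Thm. 4.10(b) and Thm. 2.8] -/
theorem kuriharaExactOrderRankOneAtThree_of_isKolyvaginSystem_powMul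
    (hPT : poitouTate_sum_localTatePairing_eq_zero ℚ)
    (hEP : ∀ v : HeightOneSpectrum (𝓞 ℚ), localEulerPoincareCharacteristic (v.adicCompletion ℚ))
    (hcore : ∀ (W : WeierstrassCurve ℚ) [W.IsElliptic] [W.IsGloballyMinimal],
      W.analyticRank = 1 →
      ∀ (P : W.toAffine.Point), ¬ IsOfFinAddOrder P →
        (∀ Q : W.toAffine.Point, ∃ n : ℤ, IsOfFinAddOrder (Q - n • P)) →
      (∀ T : W.toAffine.Point, 3 • T = 0 → T = 0) →
      W.HasSurjectiveModNGaloisRep 3 →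
      W.HasGoodReductionAtPrime 3 → W.frobeniusTrace 3 ≠ 1 → W.frobeniusTrace 3 ≠ -2 →
      ¬ O5.PointLocallyThreeDivisibleAt W 3 P →
      ∀ (q : ℚ) (s : ℕ), shaAn W = (q : ℂ) → padicValRat 3 q = s →
      ∀ {N : ℕ} [NeZero N] (D : ModularParametrizationData W N),
        ¬ (3 : ℤ) ∣ D.maninConstant →
        (∃ u : ℚ, ‖(u : ℚ_[3])‖ = 1 ∧ W.realPeriodRat = u * plusPeriod D.f) →
      ∀ (ℓ k : ℕ) [Fact ℓ.Prime], 1 ≤ k → Kato.IsKolyvaginPrime W 3 k ℓ →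
        IsCyclicKolyvaginLevel W 3 ℓ →
      ∀ (vℓ v₃ : HeightOneSpectrum (𝓞 ℚ)), (ℓ : 𝓞 ℚ) ∈ vℓ.asIdeal → ((3 : ℕ) : 𝓞 ℚ) ∈ v₃.asIdeal →
        ∀ ψ : (q : ℕ) → (ZMod q)ˣ →* Multiplicative (ZMod (3 ^ k)),
          (∀ q ∈ ℓ.primeFactors, Function.Surjective (ψ q)) →
            ∃ (k' : ℕ) (_ : k ≤ k' + 1) (_ : Kato.IsKolyvaginPrime W 3 (k' + 1) ℓ) (u : ℕ) (_ : ¬ 3 ∣ u)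
              (hdiv : ∀ X : geomPoints W, ∃ R : geomPoints W, (((3 : ℕ) : ℤ) ^ k' * ((3 : ℕ) : ℤ)) • R = X)
              (KD : KolyvaginDatum (W.torsionGaloisModule (((3 : ℕ) : ℤ) ^ k' * ((3 : ℕ) : ℤ))))
              (_ : vℓ ∈ KD.primes)
              (_ : Function.Bijective fun y : unramifiedSubgroup
                (GaloisRep.toLocal vℓ (W.torsionGaloisModule (((3 : ℕ) : ℤ) ^ k' * ((3 : ℕ) : ℤ)))) 1 => KD.fs vℓ y)
              (𝓕 : SelmerStructure (W.torsionGaloisModule (((3 : ℕ) : ℤ) ^ k' * ((3 : ℕ) : ℤ))))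
              (_ : ∀ v : Place ℚ, v ≠ Sum.inr vℓ → v ≠ Sum.inr v₃ →
                𝓕 v ≤ W.kummerSelmerStructure (((3 : ℕ) : ℤ) ^ k' * ((3 : ℕ) : ℤ)) v)
              (κ : Finset (HeightOneSpectrum (𝓞 ℚ)) →
                galoisCohomology (W.torsionGaloisModule (((3 : ℕ) : ℤ) ^ k' * ((3 : ℕ) : ℤ))) 1)
              (_ : KD.IsKolyvaginSystem 𝓕 κ)
              (_ : κ ∅ = kummerMapTorsion W (((3 : ℕ) : ℤ) ^ k' * ((3 : ℕ) : ℤ)) hdiv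
                ((3 ^ (s + padicValNat 3 W.tamagawaProduct) * u) • P)),
              ∀ ψp : galoisCohomology ((W.torsionGaloisModule (((3 : ℕ) : ℤ) ^ k' * ((3 : ℕ) : ℤ))).toLocal
                    (Sum.inr v₃)) 1 ⧸
                  W.kummerSelmerStructure (((3 : ℕ) : ℤ) ^ k' * ((3 : ℕ) : ℤ)) (Sum.inr v₃) ≃+ ZMod (3 ^ (k' + 1)),
                (haveI : NeZero ℓ := ⟨(Fact.out : ℓ.Prime).ne_zero⟩
                 zmodPowOrd 3 k (kuriharaNumber D.f (3 ^ k) ℓ ψ)) =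
                  min k (zmodPowOrd 3 (k' + 1) (ψp (galoisCohomology.localization
                    (W.torsionGaloisModule (((3 : ℕ) : ℤ) ^ k' * ((3 : ℕ) : ℤ))) (Sum.inr v₃) 1 (κ {vℓ}))))) :
    KuriharaExactOrderRankOneAtThree :=
  haveI : Fact (Nat.Prime 3) := ⟨Nat.prime_three⟩
  kuriharaExactOrderRankOneAtThree_of_kolyvaginKimDatum hPT hEP
    fun W _ _ hr P hP hgen htors hsurj hgood ha1 ha2 hm0 q s hq hs N _ D hManin hper ℓ k _ hk hKP hcyc vℓ v₃ hvℓ hv₃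
      ψ hψ => by
      obtain ⟨k', hkn, hKPn, u, hu, hdiv, KD, hDℓ, hbij, 𝓕, h𝓕, κ, hκ, h1, hkim⟩ :=
        hcore W hr P hP hgen htors hsurj hgood ha1 ha2 hm0 q s hq hs D hManin hper ℓ k hk hKP hcyc vℓ v₃ hvℓ hv₃ ψ hψ
      obtain ⟨hpv, hgoodℓ⟩ := IsKolyvaginPrime.not_mem_and_hasGoodReductionAt W hKPn hvℓ
      exact ⟨k' + 1, hkn, hKPn, u, hu, kolyvaginKimDatum_of_isKolyvaginSystem_powMul W D.f 3 ℓ k k' _ vℓ v₃ ψ hdiv hpv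
        hgoodℓ hDℓ hbij h𝓕 hκ h1 hkim⟩

end Closed

end Summit.BirchSwinnertonDyer.Rank1Residual.Ordinary

end
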